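import Summits.QuantumFields.BalabanUV.InfraRed.StrongCouplingQuarterModulusTwoSevenths
import HarnessLib

/-!
# StrongCouplingDoorCeilings — floor meets ceiling for the three Dobrushin doors of `SU(2)`, `d = 4`, with NO hypothesis

observatory of the non-perturbative crossover; no mass-gap claim.

Every strong-coupling door of this lineage has the shape

  `OneLinkKRModulusSU2 βW K₂ → D · βW · K₂ < 1 → ⟨currency at Wilson coupling βW⟩`

with the Dobrushin row count `D = 18` (single-site door; SC-a ∕ SC-b ∕ SC-c, tree
`StrongCouplingDobrushinWindow` ∕ `StrongCouplingTorusWindow` ∕ `StrongCouplingOpenWindow`), `D = 15` (forest door, SC-b,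
`StrongCouplingForestDoor.forestDobrushinDoor`) and `D = 14` (temporal axial door on the open-time slab, SC-c,
`StrongCouplingSlabAxialClustering.su2_latticeMassGap_of_oneLinkKRModulusSU2_axial`).  R21's floor
`StrongCouplingDobrushinFloor.oneLinkKRModulusSU2_floor : 0 < βW → OneLinkKRModulusSU2 βW K₂ → 1/4 ≤ K₂` caps a door with
row count `D` at `βW < 4/D`; the quarter-modulus certificates of the tree (`quarterModulus` up to `2/9`,
`oneLinkKRModulusSU2_of_le_fourFifteenths`, `oneLinkKRModulusSU2_of_le_twoSevenths`) reach each cap.  This file records,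
for the ledger's lever map, the resulting HYPOTHESIS-FREE equivalences (`βW ≥ 0`)

  `(∃ K₂, 0 ≤ K₂ ∧ OneLinkKRModulusSU2 βW K₂ ∧ D · βW · K₂ < 1) ↔ βW < 4/D`,  `D = 18, 15, 14`,

i.e. the set of Wilson couplings at which a door's two hypotheses CAN be met is exactly `[0, 2/9)`, `[0, 4/15)`, `[0, 2/7)`:
each door is open up to its ceiling and no modulus certificate whatsoever opens it further ("every rung a theorem and the
ceiling a theorem").  Main statements:

* `door_ceiling`, `door_closed`, `door_iff` — the generic row-count-`D` bookkeeping (floor `K₂ ≥ 1/4` in, `βW < 4/D` out);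
* `su2_singleSiteDoor_iff` (`D = 18`, ceiling `2/9`; R21's `su2_door_iff_of_quarterModulus` with its hypothesis
  `QuarterModulus` now DISCHARGED by the tree theorem `quarterModulus`);
* `su2_forestDoor_iff`, `su2_forestDoor_ceiling`, `su2_forestDoor_closed` (`D = 15`, ceiling `4/15`);
* `su2_axialDoor_iff`, `su2_axialDoor_ceiling`, `su2_axialDoor_closed` (`D = 14`, ceiling `2/7`);
* `su2_latticeMassGap_axial_fiftySevenTwoHundredths` — the SC-c instance at `β_W = 57/200 = 0.285`, the largest filed inside `[0, 2/7)`.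

WHAT THIS IS NOT: pure arithmetic over the floor theorem and the certificates; it says nothing about the lattice theory at
`βW ≥ 2/7` (other methods — cluster expansions, block conditions — are not excluded by anything here), nothing about the
crossover, scaling or the continuum; `[folklore]` throughout; no statement of the manuscripts under audit is used.
observatory of the non-perturbative crossover; no mass-gap claim.
-/

noncomputable section

open Literature.MathematicalPhysics.QuantumFieldTheory.Balaban1983to89.StrongCouplingDobrushinWindow (OneLinkKRModulusSU2)
open Summit.QuantumFields.BalabanUV.InfraRed.StrongCouplingDobrushinFloor
  (oneLinkKRModulusSU2_floor su2_door_iff_of_quarterModulus)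
open Summit.QuantumFields.BalabanUV.InfraRed.StrongCouplingQuarterModulusFourFifteenths
  (quarterModulus oneLinkKRModulusSU2_of_le_fourFifteenths)
open Summit.QuantumFields.BalabanUV.InfraRed.StrongCouplingQuarterModulusTwoSevenths
  (oneLinkKRModulusSU2_of_le_twoSevenths su2_latticeMassGap_axial_lt_twoSevenths)

namespace Summit.QuantumFields.BalabanUV.InfraRed.StrongCouplingDoorCeilings

/-! ## 1. Generic bookkeeping for a door with Dobrushin row count `D` -/

/-- **Ceiling of a row-count-`D` door.**  The door's hypotheses at `βW > 0` force `βW < 4/D` (floor `K₂ ≥ 1/4`).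
[folklore] -/
theorem door_ceiling {D βW K₂ : ℝ} (hD : 0 < D) (hβ : 0 < βW) (hmod : OneLinkKRModulusSU2 βW K₂)
    (hwin : D * βW * K₂ < 1) : βW < 4 / D := by
  have hK := oneLinkKRModulusSU2_floor hβ hmod
  have h1 : D * βW * (1 / 4) ≤ D * βW * K₂ := mul_le_mul_of_nonneg_left hK (by positivity)
  rw [lt_div_iff₀ hD]
  nlinarith

/-- The ceiling, contrapositive form: at `βW ≥ 4/D` the smallness condition fails for every admissible `K₂`.
[folklore] -/
theorem door_closed {D βW K₂ : ℝ} (hD : 0 < D) (hβ : 4 / D ≤ βW) (hmod : OneLinkKRModulusSU2 βW K₂) :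
    1 ≤ D * βW * K₂ := by
  have h4 : 0 < 4 / D := by positivity
  have hK := oneLinkKRModulusSU2_floor (lt_of_lt_of_le h4 hβ) hmod
  have h1 : D * βW * (1 / 4) ≤ D * βW * K₂ :=
    mul_le_mul_of_nonneg_left hK (by nlinarith [mul_pos hD (lt_of_lt_of_le h4 hβ)])
  have h2 : 4 ≤ D * βW := by
    have := (div_le_iff₀ hD).mp hβ
    linarith [mul_comm βW D]
  nlinarith

/-- **Floor meets ceiling for a row-count-`D` door.**  Given the quarter modulus `OneLinkKRModulusSU2 βW (1/4)` at every
`0 ≤ βW < 4/D`, the door's two hypotheses can be met at `βW ≥ 0` if and only if `βW < 4/D`. [folklore] -/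
theorem door_iff {D : ℝ} (hD : 0 < D) (hcert : ∀ βW : ℝ, 0 ≤ βW → βW < 4 / D → OneLinkKRModulusSU2 βW (1 / 4))
    {βW : ℝ} (h0 : 0 ≤ βW) :
    (∃ K₂ : ℝ, 0 ≤ K₂ ∧ OneLinkKRModulusSU2 βW K₂ ∧ D * βW * K₂ < 1) ↔ βW < 4 / D := by
  constructor
  · rintro ⟨K₂, -, hmod, hwin⟩
    rcases eq_or_lt_of_le h0 with h00 | hpos
    · rw [← h00]; positivity
    · exact door_ceiling hD hpos hmod hwin
  · intro hlt
    refine ⟨1 / 4, by norm_num, hcert βW h0 hlt, ?_⟩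
    have h1 : βW * D < 4 := (lt_div_iff₀ hD).mp hlt
    nlinarith

/-! ## 2. The three doors of the lineage, hypothesis-free -/

/-- **Single-site door (`D = 18`; SC-a ∕ SC-b ∕ SC-c): open exactly on `[0, 2/9)`.**  R21's
`su2_door_iff_of_quarterModulus` with its hypothesis `QuarterModulus` discharged by the tree theorem
`StrongCouplingQuarterModulusFourFifteenths.quarterModulus`. [folklore] -/
theorem su2_singleSiteDoor_iff {βW : ℝ} (h0 : 0 ≤ βW) :
    (∃ K₂ : ℝ, 0 ≤ K₂ ∧ OneLinkKRModulusSU2 βW K₂ ∧ 18 * βW * K₂ < 1) ↔ βW < 2 / 9 :=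
  su2_door_iff_of_quarterModulus quarterModulus h0

/-- **Forest door (`D = 15`; SC-b): open exactly on `[0, 4/15)`.** [folklore] -/
theorem su2_forestDoor_iff {βW : ℝ} (h0 : 0 ≤ βW) :
    (∃ K₂ : ℝ, 0 ≤ K₂ ∧ OneLinkKRModulusSU2 βW K₂ ∧ 15 * βW * K₂ < 1) ↔ βW < 4 / 15 :=
  door_iff (D := 15) (by norm_num) (fun b _ hb => oneLinkKRModulusSU2_of_le_fourFifteenths hb.le) h0

/-- Forest door, ceiling: its hypotheses at `βW > 0` force `βW < 4/15`. [folklore] -/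
theorem su2_forestDoor_ceiling {βW K₂ : ℝ} (hβ : 0 < βW) (hmod : OneLinkKRModulusSU2 βW K₂)
    (hwin : 15 * βW * K₂ < 1) : βW < 4 / 15 :=
  door_ceiling (D := 15) (by norm_num) hβ hmod hwin

/-- Forest door, closed form: at `βW ≥ 4/15` the smallness condition `15 βW K₂ < 1` fails for every admissible `K₂`.
[folklore] -/
theorem su2_forestDoor_closed {βW K₂ : ℝ} (hβ : 4 / 15 ≤ βW) (hmod : OneLinkKRModulusSU2 βW K₂) :
    1 ≤ 15 * βW * K₂ :=
  door_closed (D := 15) (by norm_num) hβ hmod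

/-- **Temporal axial door (`D = 14`; SC-c): open exactly on `[0, 2/7)`** — the quarter modulus up to `2/7`
(`oneLinkKRModulusSU2_of_le_twoSevenths`, F4(12/7)) in, R21's floor out. [folklore] -/
theorem su2_axialDoor_iff {βW : ℝ} (h0 : 0 ≤ βW) :
    (∃ K₂ : ℝ, 0 ≤ K₂ ∧ OneLinkKRModulusSU2 βW K₂ ∧ 14 * βW * K₂ < 1) ↔ βW < 2 / 7 := by
  have h := door_iff (D := 14) (by norm_num) (fun b _ hb => oneLinkKRModulusSU2_of_le_twoSevenths
    (hb.le.trans (by norm_num))) h0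
  norm_num at h
  exact h

/-- Axial door, ceiling: its hypotheses at `βW > 0` force `βW < 2/7` — no modulus certificate can push the SC-c front of
this scheme to `β_W ≥ 2/7 = 0.2857…`. [folklore] -/
theorem su2_axialDoor_ceiling {βW K₂ : ℝ} (hβ : 0 < βW) (hmod : OneLinkKRModulusSU2 βW K₂)
    (hwin : 14 * βW * K₂ < 1) : βW < 2 / 7 := by
  have h := door_ceiling (D := 14) (by norm_num) hβ hmod hwin
  linarith [show (4 : ℝ) / 14 = 2 / 7 by norm_num]

/-- Axial door, closed form: at `βW ≥ 2/7` the smallness condition `14 βW K₂ < 1` fails for every admissible `K₂`.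
[folklore] -/
theorem su2_axialDoor_closed {βW K₂ : ℝ} (hβ : 2 / 7 ≤ βW) (hmod : OneLinkKRModulusSU2 βW K₂) :
    1 ≤ 14 * βW * K₂ :=
  door_closed (D := 14) (by norm_num) (by linarith [show (4 : ℝ) / 14 = 2 / 7 by norm_num]) hmod

/-- **SC-c instance at `β_W = 57/200 = 0.285`** (tree coupling `57/400`; `14·β_W·¼ = 399/400 < 1`, rate
`krRate (399/400) = −log 0.9975`): the largest instance filed inside the half-open axial window `[0, 2/7)` of
`su2_latticeMassGap_axial_lt_twoSevenths` — the Dobrushin rate of the method, not a physical mass. [folklore] -/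
theorem su2_latticeMassGap_axial_fiftySevenTwoHundredths :
    Literature.MathematicalPhysics.QuantumFieldTheory.Balaban1983to89.CrossoverLedger.LatticeMassGap
      (Literature.MathematicalPhysics.QuantumLattice.fundamentalRep (Fin 2)) ((57 / 200 : ℝ) / 2)
      (Literature.MathematicalPhysics.QuantumFieldTheory.Balaban1983to89.StrongCouplingTorusWindow.krRate
        (14 * (57 / 200 : ℝ) * (1 / 4))) :=
  su2_latticeMassGap_axial_lt_twoSevenths (by norm_num) (by norm_num)

end Summit.QuantumFields.BalabanUV.InfraRed.StrongCouplingDoorCeilings
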